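import Summits.QuantumFields.YangMills.Theorems.ShellRigidity.Negative.LoadBearing
import Summits.QuantumFields.YangMills.Theorems.ShellRigidity.Negative.PlanarThresholdSharp
import Summits.QuantumFields.YangMills.Theorems.ShellRigidity.Negative.TransverseSmearingLoadBearing

/-!
# Disproof of `ShellRigidity` — standing adversary file for crux stmt-QuantumFields-11685
# (`Summit.QuantumFields.YangMills.Theses.PencilRigidity.ShellRigidity`, route PencilRigidity, rank 2)

Refuter lineage `cdisprove-stmt-QuantumFields-11685` (cycle 1: seat `…-0`; cycle 2: seat `…-g2-0`;
cycle 3: seat `…-g3-0`, 2026-08-16). Lean only; prose lives in docstrings. `lean check` rc 0; exactly ONE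
`sorry` (`K6_diag_positive`, the isolated obstruction of §A.3); axioms {propext, Classical.choice, Quot.sound}.
Cycle 3 replaces the inline copy of the landed §B file by an import + re-exports; §B2 (`PlanarPointwiseSharp`,
landed p78085) is still UNBUILT on the farm at 04:50Z, so its content stays inline (verbatim, this namespace).

## Findings — index

* **§A LOAD-BEARING HYPOTHESES** (cycle 1, LANDED `…/Theorems/ShellRigidity/Negative/LoadBearing.lean`,
  p73865; re-exported): `without_B4` — drop `W(B₄)` and `K x = cos (x 2)` kills it; `without_diag` — drop
  the diagonal mirror and `exp (−‖x‖₁)` kills it. ANY proof must use both (both leads do: `W(B₄)` in the glue,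
  the diagonal clause in `kernel45_axisRP` / the `K' = K ∘ R₋₄₅` family).
* **§A.3 THE AXIS MIRROR IS LOAD-BEARING GIVEN THE TWELVE DIAGONAL MIRRORS** (cycle 2 paper + symbol algebra;
  cycle 3: the witness is now EXPLICIT IN LEAN with every clause but one kernel-checked). Witness
  `K₆ = −Σ_μ ∂_μ⁶|x|⁻² = −720 Σ_μ q₆(x_μ,|x|²)/|x|¹⁴` (`K6`, `q6`): `K6_hypercubic` (`W(B₄)`), `continuousOn_K6`,
  `abs_K6_le` (`|K₆ x| ≤ 184320(1 + |x|^{2−10})`, `η = 2`), `K6_not_radial` (`K₆(e₀) = −2880`,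
  `K₆((e₀+e₁)/√2) = +2880`), `K6_not_axis_positive` (the ONE-POINT axis Gram `K₆(2e₀) < 0` — so `K₆` is
  consistent with the full crux), and the headline `shellRigidity_false_without_axis : ¬ ShellRigidityWithoutAxis`
  PROVED from the single sorried lemma `K6_diag_positive` (pointwise positivity of `K₆` across `x₀ = x₁`; paper
  proof = half-space Laplace–Fourier representation of `|x|⁻²` in the frame of `n = (e₀−e₁)/√2` + the
  kernel-checked symbol sign `diagSymbol_sextic_nonneg`; numerics: cycle-3 pure-python Gram test, 400 random
  diagonal-side configurations of 2–9 points, min normalised eigenvalue `+1.2·10⁻¹³`, derivative formula verified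
  symbolically; cycle-2 kit job j010725). Why it is not closed: Mathlib has no spherical/cylindrical Fourier
  computation on `ℝ³` (`∫ e^{−|q|u+iq·w}d³q/|q| = 4π/(u²+|w|²)`), and every Gram factorisation of
  `1/((uᵢ+uⱼ)²+|wᵢ−wⱼ|²)` needs `sinc|w|` (or the half-space Poisson kernel) positive-definite on `ℝ³` — the same
  transform. No BOUNDED witness exists in the known families (bounded `O(4)`-invariant RP kernels are constant;
  orbit sums of plane waves / `e^{−|x·n|}` die on oblique root pairs), so any `WithoutAxis` witness is singular.
* **§B PLANAR THRESHOLD `σ = 8` IS SHARP** (cycle 2, LANDED `Negative/PlanarThresholdSharp.lean` p76045 and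
  `Negative/PlanarPointwiseSharp.lean` p78085; re-exported as `planarThreshold_sharp`; §B2 inline: `sum_mul_mul_nonneg_of_laplaceRep`,
  `isPlanarMirrorKernel_F8`, `not_planarShellRigidityLe8`): `F₈ = cos 8φ/r⁸` with the cone-boundary measures
  `½p⁷e^{−εp}/7!` on `p₁ = ±p₀` satisfies every hypothesis of `stub_planarAngularRigidity` with `σ = 8` (and is
  pointwise four-mirror positive) and is not radial.
* **§B3 `stub_fourierVanish` IS SHARP AT `σ = 8`** (cycle 3, NEW, kernel-checked here; standalone file
  `Negative/FourierVanishSharp.lean` submitted): lead skeleton v3 splits stub 7 into `stub_angularChart` +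
  `stub_fourierVanish`; the latter with `σ < 8` relaxed to `σ ≤ 8` is FALSE (`not_fourierVanishLe8`): `g = cos 8x`,
  chart `h = cos 8w` (entire, `π/2`-periodic, equal values on `Re w = ±π/4`, `‖cos 8w‖ ≤ e^{8|Im w|}` so `A = 0`,
  `B = 1`), and `cos 8x ∉ span{1, e^{±4ix}}` (evaluate at `0, π/4, ±π/8`). One-variable core of §B; a test case
  for the stub's worker (the contour bound `(A + Be^{σ|ψ|})e^{−4|n||ψ|}` is attained by `n = ±2`).
* **§B4 drefute's load-bearing lemmas** (LANDED `Negative/TransverseSmearingLoadBearing.lean`, p75006;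
  re-exported): `coneOfDiscSections_needs_uniform_bound` (`∃M ∀t`, not `∀t ∃M`: Dirac at `e₁`),
  `axisLaplace_needs_parity` (`e^{−|x₀|}(1 + ½ sin x₁)`).
* **§C TARGETS — cycle-3 audit of EVERY open stub of BOTH leads** (lead 1 skeleton v3 sha 787c769ac739:
  `stub_angularChart`, `stub_fourierVanish`, `stub_planarAngularRigidity` (assembly), `stub_planarRadial`
  (assembly), `stub_smearTransport` (proved by its worker); lead b skeleton v3.1: `stub_angleBandLimit`,
  `stub_transversePinch`, `stub_smearedChartIdentity`, `stub_transverseSmearBound`, `stub_boxMeanVanish`):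
  NONE false, NONE mis-stated, including at the level of Lean junk values. Per-stub notes in §C below — the
  provers' briefing.
* **§D WHY THE CRUX RESISTS — cycle-3 verdict.** Unchanged and sharpened: `ShellRigidity` is a theorem on paper,
  and lead 1 is two one-variable complex-analysis lemmas (`stub_angularChart`: dominated holomorphic parameter
  integral; `stub_fourierVanish`: Cauchy on a rectangle + Fourier uniqueness) and two assemblies away from closing
  it by name; lead b's independent back end is also sound (§C). Every quantitative threshold in either chain is
  exactly the crux's `η > 0` (§B, §B3: `σ = 8 − η < 8`; lead b: `a − 2 < 8`). A counterexample to the crux would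
  now have to contradict the Paley–Wiener/Fourier-uniqueness content of `stub_fourierVanish` or dominated
  convergence — there is none. Residual prover risk is purely formal (Mathlib plumbing), not mathematical.
* **§E ATTACK LOG** (cumulative) — end of this docblock.

## §C — Targets: cycle-3 paper audit of the open stubs (no kill, no mis-statement)

Lead 1 (line `transverse-smearing-planar-threshold`, v3):
* `stub_angularChart`: TRUE. On the open rectangle `m_w − ε > 0` STRICTLY (`cos` strictly decreasing on
  `[0, 3π/8] ⊂ [0, π]`, `e^{−|Im w|} > e^{−Ψ}`, `r > 0`), so both integrands are a.e. bounded by `1` on the cone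
  (`|cos(x+iy)| ≤ cosh y ≤ e^{|y|}`, `|p₁| ≤ p₀`, `cosh ψ − |sinh ψ| = e^{−|ψ|}`) and integrable; `‖∫f‖ ≤ ∫‖f‖`
  gives (2); (3) is linearity with `cos θ = (e^{iθ}+e^{−iθ})/2`, both pieces integrable since `r cos α > ε`;
  (4) `H(−w) = H(w)` for ALL `w ∈ ℂ` is a pointwise identity of integrands (`cos`, and `cos ∘ (r sin(−w)·)`, are
  even) — it holds even where nothing is integrable; (5) at `w = iχ` the integrand is
  `e^{−(r cosh χ − ε)p₀} cosh(r sinh χ p₁)`, pointwise real `≥ 0`, so `im = 0`, `re ≥ 0` (trivially so if not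
  integrable: Bochner junk `0`). (1) is the dominated holomorphic parameter integral (local uniform bound `1`).
  Nearest Mathlib: `hasDerivAt_integral_of_dominated_loc_of_deriv_le`, `DifferentiableOn.analyticOn`-free route
  via `Complex.differentiableOn_tsum`-style is not needed — differentiate under `∫` once.
* `stub_fourierVanish`: TRUE for `σ < 8`, FALSE for `σ = 8` (§B3). Proof audited: Cauchy on
  `[−π/4, π/4] × [0, ψ]` (`ψ` of either sign, `|ψ| < Ψ`, closed rectangle inside the open one since
  `π/4 < 3π/8`), vertical sides cancel by the `Re w = ±π/4` hypothesis and `e^{−4in(±π/4)} = (−1)ⁿ`,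
  `|ĝ(n)| ≤ (π/2)(|A| + |B|e^{max(σ,0)|ψ|})e^{−4|n||ψ|} → 0` for `|n| ≥ 2` (all `Ψ`, `A,B` fixed); a continuous
  function on `AddCircle (π/2)` with all coefficients `|n| ≥ 2` zero is `c₀ + c₁e^{4ix} + c₂e^{−4ix}`
  (`fourierBasis` is a Hilbert basis; continuity upgrades a.e. to everywhere). Remarks for the worker: the
  hypothesis `h(π/4+iy) = h(−π/4+iy)` is implied by periodicity of `g` + the identity theorem on the connected
  overlap, but is given, so no gluing is needed inside this stub; `σ ≤ 0` and `B < 0` are harmless.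
* `stub_planarAngularRigidity` (assembly): TRUE. `ε = r cos(3π/8)e^{−Ψ}`; `H_A = g`, `H_D(· + π/4) = g` on the
  real segment of the CONVEX overlap `Re w ∈ (−3π/8, π/8)` (uses `D₄`: `F` even in `s` and `g` `π/2`-periodic);
  evenness of both charts gives the vertical-line condition; bound `‖H_A w‖ ≤ F(m_w,0) ≤ C + C(r cos 3π/8)^{−σ}
  e^{σ|Im w|}` with `A, B` independent of `Ψ` ✓. Final positivity with COMPLEX `cᵢ`: imaginary parts of
  `c₀ ± (c₁e^{−4χ} + c₂e^{4χ})` vanish for all `χ` ⇒ `c₀, c₁, c₂` real; then `|c₁e^{−4χ}+c₂e^{4χ}| ≤ c₀` for all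
  `χ` ⇒ `c₁ = c₂ = 0`.
* `stub_planarRadial` (assembly): TRUE — `stub_planarDiscSections` (landed) fed by `hD` gives disc sections of
  `b ↦ F(ε+t,b)` with `M` uniform in `t`, exactly the `hdisc` of `stub_coneOfDiscSections` (landed) for the axis
  measure of `hA`; same for `Φ = F ∘ L`; then `stub_planarAngularRigidity`.
* `stub_smearTransport`: proved by its worker (skeleton docstring); `F 0` is junk and never used.

Lead b (line `thales-slit-exact-cone-type`, v3.1):
* `stub_angleBandLimit` (`a < 12`): TRUE. Continuity of `K` off the plane `{x₀ = x₁ = 0}` is automatic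
  (`hrep` ⇒ continuous on `{x₀ > 0}`; `hrot`); the chart lens `{t cos(Re w)e^{−|Im w|} > ε, |Re w| < π/2}` is
  star-shaped, contains `iχ` iff `te^{−|χ|} > ε` (the stated side condition), and the `π/2`-shifted lens meets
  it in a connected set containing a real interval, so the chart is `π/2`-periodic where needed; modes `|n| ≥ 3`
  die iff `a < 12`; the chart identity at `iχ` has the right sign `−t sinh χ · p₁` (`i t sin(iχ) = −t sinh χ`).
* `stub_transversePinch` (`2 < a < 10`): TRUE, and the `∀ y z` conclusion is reachable: by the chart identity
  `(y,z) ↦ P_χ(y,z) := Σ_k b_k(t,y,z) cosh 4kχ` is the Fourier transform of a POSITIVE finite measure, so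
  `|P_χ(y,z)| ≤ P_χ(0,0)`, `b₂(t,·) = lim_χ P_χ/cosh 8χ` is positive-definite, and `b₂(t,0) = 0` (smeared pinch,
  `a − 2 < 8`, + `stub_boxMeanVanish`) forces `b₂ ≡ 0`; then `±b₁(t,·)` are positive-definite (axis/diagonal
  charts, `b' = (b₀, −b₁, b₂)` by uniqueness of the `{1, cos 4φ, cos 8φ}` expansion), so `b₁ ≡ 0`. The `μ ↔ K`
  link on the axis is implied by `hb` at `χ = 0` (`Σ b_k = K(t,0,y,z)`). For `a < 8` no smearing is needed.
* `stub_smearedChartIdentity`, `stub_transverseSmearBound`, `stub_boxMeanVanish`: TRUE (Fubini with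
  `Φ = |1̂_{[0,δ]²}(p₂,p₃)|² ∈ [0, δ⁴]`, integrand `≤ 1` a.e. since `p₀ ≥ |p₁|` on the cone;
  `∫_{ℝ²}(s²+|z|²)^{−a/2}dz = c_a s^{2−a}` finite iff `a > 2`, inner integrals of a continuous `K(s,0,·)` over
  compact boxes are honest; `δ⁻⁴∫∫ c(w−w') → c(0)` by continuity).

## §E — attack log (cumulative)

cycle 1 (seat -0): CBF/Lévy exponents, orbit sums of `Π 2m_μ/(k_μ²+m_μ²)` and plane waves, ℓ¹-radial and
separable mixtures, transplanted 2D `D₄` toys (LP game value −0.266 on `exp(−α|t|−β|s|)` mixtures),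
Gaussians, lattice propagators — all die on the diagonal mirror or on `W(B₄)`; landed §A. Earlier seats
(rattack/rreview, EVIDENCE.md on the item): multi-affine Cauchy conditionals `1/(k²+m²+c e₂)` (ACS §5.5),
quartic/sextic/dressed-KL tops (axis/diagonal shell-sign pincer), homogeneous `h(k̂)/|k|²`, composites of
O(4) theories (spin-4 unitarity ⇒ `|x|⁻¹²`; the descendant `(Σ∂⁴)φ` is the sharp `|x|⁻¹⁰` witness),
Gaussian vector multiplets; sub-case `η > 8` proved true (Tauberian vs Stieltjes envelope).
cycle 2 (seat -g2-0): structural audit of the picked line v2 (every stub re-derived on paper); the planar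
threshold realised exactly (§B, Lean, landed ×2); symbol calculus for derivative dressings `K = P(∂)G_m`
(pointwise 16-RP ⟺ `P(−ω, ip) ≥ 0` on every mass shell in the axis AND the light-cone frame; degree 4 is the
pincer `lightCone_quartic_onShell`; the first frame-positive anisotropic symbol is `(Σk_μ⁴)²`, degree 8 ⇒
`|x|⁻¹⁰`, confirming `η > 0` exactly tight); hypotheses dropped: growth (not load-bearing: stub 1, landed),
axis given diagonals (paper witness `−Σ∂⁶|x|⁻²`).
cycle 3 (this seat): (1) audit of lead 1's skeleton v3 and of lead b's five stubs (§C) — no kill; (2) §B3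
`stub_fourierVanish` sharp at `σ = 8` (Lean, submitted as `Negative/FourierVanishSharp.lean`); (3) §A.3 witness
`K₆` written out and kernel-checked except `K6_diag_positive` (numerics: 400 random configurations); (4) more
hypothesis drops — CONTINUITY: `1 + c·1_T` for `T` = the 4 axes ∪ 12 diagonal lines is killed for `c > 0` on the
diagonal mirror by the 3-point configuration `x₁=(a,b,·), x₂=(c,a,·), x₃=(d,c,·)`, `b<a<c<d`, `v = (1,−2,1)`
(`vᵀMv = −2c`), for `c < 0` on the axis mirror by two spatial blocks; sums of mirror-HYPERPLANE indicators die
on the time–space diagonals (relation `tᵢ+tⱼ = ∓Δyᵏ` is not an equivalence); subgroup indicators `1_Λ` die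
because `θ` acts as an involution on `ℝ⁴/Λ`-classes (`[[0,1],[1,0]]` blocks) — no cheap discontinuous witness,
and continuity may well be removable (the representation makes `K` continuous on `{x₀ ≠ 0}` for free);
BOUNDEDNESS: no bounded non-constant `O(4)`-invariant RP kernel exists (KL kernels are singular at `0`), so
bounded `WithoutAxis` witnesses would have to be genuinely anisotropic-yet-12-mirror-positive — none found in
orbit-sum / product / indicator families.
-/

namespace Summit.QuantumFields.YangMills.Cruxes.ShellRigidity.Disproof

open scoped BigOperators ComplexConjugate NNReal ENNReal
open MeasureTheory Complex Set
open Literature.MathematicalPhysics.QuantumLattice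
open Literature.Analysis.FluidPDE (IsSignedPermIsometry signedPermIsometry signedPermIsometry_apply)

noncomputable section

local notation "E4" => EuclideanSpace ℝ (Fin 4)

/-! ## §A — load-bearing hypotheses (landed; re-exported) -/

/-- §A.1 (landed, p73865): `W(B₄)`-invariance is load-bearing — witness `cos (x 2)`. -/
theorem without_B4 : ¬ Theorems.ShellRigidity.Negative.ShellRigidityWithoutB4 :=
  Theorems.ShellRigidity.Negative.shellRigidity_false_without_B4

/-- §A.2 (landed, p73865): the diagonal mirror is load-bearing — witness `exp (−‖x‖₁)`. -/
theorem without_diag : ¬ Theorems.ShellRigidity.Negative.ShellRigidityWithoutDiag :=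
  Theorems.ShellRigidity.Negative.shellRigidity_false_without_diag

/-! ## §A.3 — the AXIS mirror is load-bearing given the twelve diagonal mirrors

Symbol algebra (cycle 2, kernel-checked) followed by the explicit witness `K₆` (cycle 3, kernel-checked except
the one analytic lemma `K6_diag_positive`, the ONLY `sorry` of this file). -/

/-- Light-cone frame, sextic invariant: with `k₀ = (q₁ + iω)/√2`, `k₁ = (q₁ − iω)/√2` (the complex momenta
of the diagonal-mirror locus), `k₀⁶ + k₁⁶ = (q₁⁶ − 15q₁⁴ω² + 15q₁²ω⁴ − ω⁶)/4` (real). [folklore] -/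
theorem lightCone_sextic_re (q₁ ω : ℝ) :
    (((q₁ : ℂ) + ω * I) / (Real.sqrt 2 : ℝ)) ^ 6 + (((q₁ : ℂ) - ω * I) / (Real.sqrt 2 : ℝ)) ^ 6
      = (((q₁ ^ 6 - 15 * q₁ ^ 4 * ω ^ 2 + 15 * q₁ ^ 2 * ω ^ 4 - ω ^ 6) / 4 : ℝ) : ℂ) := by
  have hs2 : ((Real.sqrt 2 : ℝ) : ℂ) ^ 2 = 2 := by
    rw [← Complex.ofReal_pow, Real.sq_sqrt two_pos.le]; norm_num
  have hs6 : ((Real.sqrt 2 : ℝ) : ℂ) ^ 6 = 8 := by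
    rw [show ((Real.sqrt 2 : ℝ) : ℂ) ^ 6 = ((((Real.sqrt 2 : ℝ)) : ℂ) ^ 2) ^ 3 by ring, hs2]; norm_num
  have key : ((q₁ : ℂ) + ω * I) ^ 6 + ((q₁ : ℂ) - ω * I) ^ 6
      = ((2 * (q₁ ^ 6 - 15 * q₁ ^ 4 * ω ^ 2 + 15 * q₁ ^ 2 * ω ^ 4 - ω ^ 6) : ℝ) : ℂ) := by
    push_cast
    linear_combination (2 * (15 * (q₁ : ℂ) ^ 4 * (ω : ℂ) ^ 2 + 15 * (q₁ : ℂ) ^ 2 * (ω : ℂ) ^ 4 * (I ^ 2 - 1)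
      + (ω : ℂ) ^ 6 * (I ^ 4 - I ^ 2 + 1))) * I_sq
  rw [div_pow, div_pow, hs6, ← add_div, key]
  push_cast; ring

/-- On the mass shell of the diagonal locus, `ω² = q₁² + M²` (`M² = q₂² + q₃² + m²`):
`(q₁⁶ − 15q₁⁴ω² + 15q₁²ω⁴ − ω⁶)/4 = (12q₁⁴M² + 12q₁²M⁴ − M⁶)/4` — the top order `q₁⁶` CANCELS and the
sextic grows like `+3M²q₁⁴` along the locus (whereas `Σk⁴ ∼ −2q₁⁴` there). [folklore] -/
theorem lightCone_sextic_onShell (q₁ M ω : ℝ) (hω : ω ^ 2 = q₁ ^ 2 + M ^ 2) :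
    (q₁ ^ 6 - 15 * q₁ ^ 4 * ω ^ 2 + 15 * q₁ ^ 2 * ω ^ 4 - ω ^ 6) / 4
      = (12 * q₁ ^ 4 * M ^ 2 + 12 * q₁ ^ 2 * M ^ 4 - M ^ 6) / 4 := by
  linear_combination ((-15 * q₁ ^ 4 + 15 * q₁ ^ 2 * (ω ^ 2 + (q₁ ^ 2 + M ^ 2))
    - (ω ^ 4 + ω ^ 2 * (q₁ ^ 2 + M ^ 2) + (q₁ ^ 2 + M ^ 2) ^ 2)) / 4) * hω

/-- **Diagonal-locus symbol of `K = −Σ_μ∂_μ⁶|x|⁻²` is nonnegative** (massless: `M² = Q = q₂² + q₃²`):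
`Σ_μ k_μ⁶ = 3q₁⁴Q + 3q₁²Q² − Q³/4 + q₂⁶ + q₃⁶ = 3q₁²Q(q₁² + Q) + ¾·Q·(q₂² − q₃²)² ≥ 0`, so (paper, via the
half-space Laplace representation of `|x|⁻²`) `K` is pointwise OS-positive across `x₀ = x₁`. [folklore] -/
theorem diagSymbol_sextic_nonneg (q₁ q₂ q₃ : ℝ) :
    0 ≤ (12 * q₁ ^ 4 * (q₂ ^ 2 + q₃ ^ 2) + 12 * q₁ ^ 2 * (q₂ ^ 2 + q₃ ^ 2) ^ 2 - (q₂ ^ 2 + q₃ ^ 2) ^ 3) / 4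
      + q₂ ^ 6 + q₃ ^ 6 := by
  have h : (12 * q₁ ^ 4 * (q₂ ^ 2 + q₃ ^ 2) + 12 * q₁ ^ 2 * (q₂ ^ 2 + q₃ ^ 2) ^ 2 - (q₂ ^ 2 + q₃ ^ 2) ^ 3) / 4
      + q₂ ^ 6 + q₃ ^ 6
      = 3 * q₁ ^ 2 * (q₂ ^ 2 + q₃ ^ 2) * (q₁ ^ 2 + (q₂ ^ 2 + q₃ ^ 2))
        + 3 / 4 * (q₂ ^ 2 + q₃ ^ 2) * (q₂ ^ 2 - q₃ ^ 2) ^ 2 := by ring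
  rw [h]; positivity

/-- **Axis-locus symbol of the same `K` is negative somewhere** (massless: `ω² = |p|²`):
`Σ_μ k_μ⁶ = −ω⁶ + Σᵢpᵢ⁶ = −6` at `p = (1,1,0)` — so `K` is NOT OS-positive across `x₀ = 0`. [folklore] -/
theorem axisSymbol_sextic_neg :
    -(((1 : ℝ) ^ 2 + 1 ^ 2 + 0 ^ 2) ^ 3) + ((1 : ℝ) ^ 6 + 1 ^ 6 + 0 ^ 6) < 0 := by norm_num

/-- Degree four dies on the diagonal locus alone (the known pincer, light-cone frame): on the shell
`ω² = q₁² + M²`, `k₀⁴ + k₁⁴ = (q₁⁴ − 6q₁²ω² + ω⁴)/2 = (−4q₁⁴ − 4q₁²M² + M⁴)/2 → −∞` in `q₁` while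
`q₂⁴ → +∞` in `q₂`, so `BΣk⁴ ≥ −A` on the locus forces `B = 0`; here the algebraic identity. [folklore] -/
theorem lightCone_quartic_onShell (q₁ M ω : ℝ) (hω : ω ^ 2 = q₁ ^ 2 + M ^ 2) :
    (q₁ ^ 4 - 6 * q₁ ^ 2 * ω ^ 2 + ω ^ 4) / 2 = (-4 * q₁ ^ 4 - 4 * q₁ ^ 2 * M ^ 2 + M ^ 4) / 2 := by
  linear_combination ((-6 * q₁ ^ 2 + ω ^ 2 + (q₁ ^ 2 + M ^ 2)) / 2) * hω

/-- The crux `ShellRigidity` with the AXIS positivity clause (across `x₀ = 0`, `timeReflection 4`) DROPPED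
and the diagonal clause (across `x₀ = x₁`) kept; everything else verbatim. -/
def ShellRigidityWithoutAxis : Prop :=
  ∀ (K : E4 → ℝ), ContinuousOn K {x : E4 | x ≠ 0} →
    (∃ C η : ℝ, 0 < η ∧ ∀ x : E4, x ≠ 0 → |K x| ≤ C * (1 + ‖x‖ ^ (η - 10))) →
    (∀ R : E4 ≃ₗᵢ[ℝ] E4, (∀ i : Fin 4, ∃ j : Fin 4, R (EuclideanSpace.single i 1) =
      EuclideanSpace.single j 1 ∨ R (EuclideanSpace.single i 1) = -EuclideanSpace.single j 1) →
      ∀ x : E4, K (R x) = K x) →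
    (∀ (m : ℕ) (x : Fin m → E4) (c : Fin m → ℝ), (∀ i, x i 1 < x i 0) →
      0 ≤ ∑ i, ∑ j, c i * c j *
        K (LinearIsometryEquiv.piLpCongrLeft 2 ℝ ℝ (Equiv.swap (0 : Fin 4) 1) (x i) - x j)) →
    ∀ (R : E4 ≃ₗᵢ[ℝ] E4) (x : E4), x ≠ 0 → K (R x) = K x

/-- One-coordinate sextic: `∂_a⁶ (a² + b²)⁻¹ = 720 · q₆(a, a² + b²) / (a² + b²)⁷` with
`q₆(a,s) = 7a⁶ − 35a⁴(s − a²) + 21a²(s − a²)² − (s − a²)³` (`= Im (a+ib)⁷ / b`). -/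
def q6 (a s : ℝ) : ℝ :=
  7 * a ^ 6 - 35 * a ^ 4 * (s - a ^ 2) + 21 * a ^ 2 * (s - a ^ 2) ^ 2 - (s - a ^ 2) ^ 3

/-- **The witness `K₆ = −Σ_μ ∂_μ⁶ |x|⁻²`**, written out as the rational function
`−720 Σ_μ q₆(x_μ, |x|²) / |x|¹⁴` (homogeneous of degree `−8`; Fourier multiplier `∝ Σ_μ k_μ⁶ / k²`). -/
def K6 (x : E4) : ℝ := -720 * (∑ μ, q6 (x μ) (‖x‖ ^ 2)) / ‖x‖ ^ 14

/-- `q₆` is even in `a`. [folklore] -/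
theorem q6_neg (a s : ℝ) : q6 (-a) s = q6 a s := by
  unfold q6; ring

/-- `q₆(±a, s) = q₆(a, s)` for a sign `u ∈ ℤˣ`. [folklore] -/
theorem q6_units_mul (u : ℤˣ) (a s : ℝ) : q6 (((u : ℤ) : ℝ) * a) s = q6 a s := by
  rcases Int.units_eq_one_or u with rfl | rfl
  · simp
  · simp [q6_neg]

/-- `K₆` is invariant under the hyperoctahedral group `W(B₄)` (signed permutations). [folklore] -/
theorem K6_hypercubic (R : E4 ≃ₗᵢ[ℝ] E4)
    (hR : ∀ i : Fin 4, ∃ j : Fin 4, R (EuclideanSpace.single i 1) = EuclideanSpace.single j 1 ∨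
      R (EuclideanSpace.single i 1) = -EuclideanSpace.single j 1) (x : E4) :
    K6 (R x) = K6 x := by
  obtain ⟨σ, s, rfl⟩ := IsSignedPermIsometry.exists_eq_signedPermIsometry hR
  unfold K6
  rw [LinearIsometryEquiv.norm_map]
  congr 2
  simp only [signedPermIsometry_apply, q6_units_mul]
  exact Equiv.sum_comp σ (fun i => q6 (x i) (‖x‖ ^ 2))

/-- `K₆` is continuous off the origin. [folklore] -/
theorem continuousOn_K6 : ContinuousOn K6 {x : E4 | x ≠ 0} := by
  have hnum : Continuous fun x : E4 => -720 * ∑ μ, q6 (x μ) (‖x‖ ^ 2) := by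
    simp only [q6]
    fun_prop
  have hden : Continuous fun x : E4 => ‖x‖ ^ 14 := continuous_norm.pow 14
  refine (hnum.continuousOn.div hden.continuousOn fun x hx => ?_)
  exact pow_ne_zero 14 (norm_ne_zero_iff.2 hx)

/-- `|q₆(a, s)| ≤ 64 s³` when `a² ≤ s`. [folklore] -/
theorem abs_q6_le (a s : ℝ) (h : a ^ 2 ≤ s) : |q6 a s| ≤ 64 * s ^ 3 := by
  set t := a ^ 2 with ht
  set b := s - a ^ 2 with hb
  have ht0 : 0 ≤ t := sq_nonneg a
  have hb0 : 0 ≤ b := by rw [hb]; linarith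
  have hts : t ≤ s := h
  have hbs : b ≤ s := by rw [hb]; linarith
  have hs0 : 0 ≤ s := ht0.trans hts
  have hq : q6 a s = 7 * t ^ 3 - 35 * t ^ 2 * b + 21 * t * b ^ 2 - b ^ 3 := by
    simp only [q6, ht, hb]; ring
  have h1 : t ^ 3 ≤ s ^ 3 := pow_le_pow_left₀ ht0 hts 3
  have h2 : b ^ 3 ≤ s ^ 3 := pow_le_pow_left₀ hb0 hbs 3
  have h3 : t ^ 2 * b ≤ s ^ 2 * s :=
    mul_le_mul (pow_le_pow_left₀ ht0 hts 2) hbs hb0 (sq_nonneg s)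
  have h4 : t * b ^ 2 ≤ s * s ^ 2 :=
    mul_le_mul hts (pow_le_pow_left₀ hb0 hbs 2) (sq_nonneg b) hs0
  have h5 : 0 ≤ t ^ 2 * b := by positivity
  have h6 : 0 ≤ t * b ^ 2 := by positivity
  have h7 : 0 ≤ t ^ 3 := by positivity
  have h8 : 0 ≤ b ^ 3 := by positivity
  rw [hq, abs_le]
  constructor <;> nlinarith

/-- The crux's growth clause for `K₆` with `η = 2`: `|K₆ x| ≤ 184320 · |x|⁻⁸ ≤ 184320 (1 + |x|^{2−10})`.
[folklore] -/
theorem abs_K6_le (x : E4) (hx : x ≠ 0) : |K6 x| ≤ 184320 * (1 + ‖x‖ ^ ((2 : ℝ) - 10)) := by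
  have hn : 0 < ‖x‖ := norm_pos_iff.2 hx
  have hcoord : ∀ μ : Fin 4, (x μ) ^ 2 ≤ ‖x‖ ^ 2 := by
    intro μ
    have h1 : |x μ| ≤ ‖x‖ := by
      have := PiLp.norm_apply_le x μ
      simpa [Real.norm_eq_abs] using this
    calc (x μ) ^ 2 = |x μ| ^ 2 := (sq_abs _).symm
      _ ≤ ‖x‖ ^ 2 := pow_le_pow_left₀ (abs_nonneg _) h1 2
  have hsum : |∑ μ, q6 (x μ) (‖x‖ ^ 2)| ≤ 256 * ‖x‖ ^ 6 := by
    calc |∑ μ, q6 (x μ) (‖x‖ ^ 2)| ≤ ∑ μ, |q6 (x μ) (‖x‖ ^ 2)| := Finset.abs_sum_le_sum_abs _ _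
      _ ≤ ∑ _μ : Fin 4, 64 * (‖x‖ ^ 2) ^ 3 :=
          Finset.sum_le_sum fun μ _ => abs_q6_le _ _ (hcoord μ)
      _ = 256 * ‖x‖ ^ 6 := by simp; ring
  have hK : |K6 x| ≤ 184320 * (‖x‖ ^ 14)⁻¹ * ‖x‖ ^ 6 := by
    unfold K6
    rw [abs_div, abs_mul, abs_of_pos (pow_pos hn 14), div_eq_mul_inv]
    have : |(-720 : ℝ)| = 720 := by norm_num
    rw [this]
    calc 720 * |∑ μ, q6 (x μ) (‖x‖ ^ 2)| * (‖x‖ ^ 14)⁻¹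
        ≤ 720 * (256 * ‖x‖ ^ 6) * (‖x‖ ^ 14)⁻¹ := by
          gcongr
      _ = 184320 * (‖x‖ ^ 14)⁻¹ * ‖x‖ ^ 6 := by ring
  have hpow : (‖x‖ ^ 14)⁻¹ * ‖x‖ ^ 6 = ‖x‖ ^ ((2 : ℝ) - 10) := by
    rw [show (2 : ℝ) - 10 = -((8 : ℕ) : ℝ) by norm_num, Real.rpow_neg hn.le, Real.rpow_natCast]
    field_simp
  calc |K6 x| ≤ 184320 * (‖x‖ ^ 14)⁻¹ * ‖x‖ ^ 6 := hK
    _ = 184320 * ‖x‖ ^ ((2 : ℝ) - 10) := by rw [mul_assoc, hpow]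
    _ ≤ 184320 * (1 + ‖x‖ ^ ((2 : ℝ) - 10)) := by
        have : (0 : ℝ) ≤ ‖x‖ ^ ((2 : ℝ) - 10) := Real.rpow_nonneg hn.le _
        nlinarith

/-- `K₆(e₀) = −2880`. [folklore] -/
theorem K6_single_zero : K6 (EuclideanSpace.single 0 1) = -2880 := by
  have hn : ‖(EuclideanSpace.single (0 : Fin 4) (1 : ℝ) : E4)‖ = 1 := by
    rw [PiLp.norm_single]; simp
  unfold K6
  rw [hn]
  simp [Fin.sum_univ_four, PiLp.single_apply, q6]
  norm_num

/-- `K₆` is not `O(4)`-invariant: `K₆(e₀) = −2880` but `K₆((e₀+e₁)/√2) = +2880`. [folklore] -/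
theorem K6_not_radial : ¬ ∀ (R : E4 ≃ₗᵢ[ℝ] E4) (x : E4), x ≠ 0 → K6 (R x) = K6 x := by
  intro h
  set a : ℝ := 1 / Real.sqrt 2 with ha_def
  have ha2 : a ^ 2 = 1 / 2 := by
    rw [ha_def, div_pow, one_pow, Real.sq_sqrt (by norm_num : (0 : ℝ) ≤ 2)]
  have ha4 : a ^ 4 = 1 / 4 := by
    rw [show a ^ 4 = (a ^ 2) ^ 2 by ring, ha2]; norm_num
  have ha6 : a ^ 6 = 1 / 8 := by
    rw [show a ^ 6 = (a ^ 2) ^ 3 by ring, ha2]; norm_num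
  set v : E4 := EuclideanSpace.single 0 1 with hv
  set w : E4 := a • EuclideanSpace.single 0 1 + a • EuclideanSpace.single 1 1 with hw
  have hw1 : ‖w‖ = 1 := by
    have hsum : ∑ i : Fin 4, ‖w i‖ ^ 2 = a ^ 2 + a ^ 2 := by
      rw [hw]; simp [Fin.sum_univ_four, PiLp.single_apply]
    rw [EuclideanSpace.norm_eq, hsum, ← two_mul, ha2]; norm_num
  have hnorm : ‖v‖ = ‖w‖ := by
    have h1 : ‖v‖ = 1 := by rw [hv, PiLp.norm_single]; simp
    rw [h1, hw1]
  set R : E4 ≃ₗᵢ[ℝ] E4 := (Submodule.span ℝ {v - w})ᗮ.reflection with hR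
  have hRv : R v = w := Submodule.reflection_sub hnorm
  have hv0 : v ≠ 0 := by
    intro h0
    have : v 0 = 0 := by rw [h0]; rfl
    simp [hv] at this
  have key := h R v hv0
  rw [hRv] at key
  have hKv : K6 v = -2880 := K6_single_zero
  have hKw : K6 w = 2880 := by
    unfold K6
    rw [hw1]
    have hw0 : w 0 = a := by simp [hw]
    have hw1' : w 1 = a := by simp [hw]
    have hw2 : w 2 = 0 := by simp [hw]
    have hw3 : w 3 = 0 := by simp [hw]
    simp only [Fin.sum_univ_four, hw0, hw1', hw2, hw3]
    have hqa : q6 a (1 ^ 2) = -1 := by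
      unfold q6
      rw [ha6, ha4, ha2]; norm_num
    have hq0 : q6 0 (1 ^ 2) = -1 := by unfold q6; norm_num
    rw [hqa, hq0]
    norm_num
  rw [hKv, hKw] at key
  norm_num at key

/-- **`K₆` violates the AXIS clause** (one-point configuration `x = e₀`: `K₆(θe₀ − e₀) = K₆(−2e₀) =
−2880/2⁸ < 0`). So the full crux is consistent with `K₆`, and `K₆` can only witness the necessity of the
axis clause. [folklore] -/
theorem K6_not_axis_positive : ¬ ∀ (m : ℕ) (x : Fin m → E4) (c : Fin m → ℝ), (∀ i, 0 < x i 0) →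
    0 ≤ ∑ i, ∑ j, c i * c j * K6 (timeReflection 4 (x i) - x j) := by
  intro h
  have key := h 1 (fun _ => EuclideanSpace.single 0 1) (fun _ => 1) (fun _ => by simp)
  simp only [Finset.univ_unique, Fin.default_eq_zero, Fin.isValue, Finset.sum_singleton,
    one_mul] at key
  have hvec : (timeReflection 4 (EuclideanSpace.single 0 1) - EuclideanSpace.single 0 1 : E4)
      = (-2 : ℝ) • EuclideanSpace.single 0 1 := by
    ext i
    fin_cases i <;> (simp [timeReflection_apply]; try norm_num)
  rw [hvec] at key
  have hn : ‖((-2 : ℝ) • EuclideanSpace.single (0 : Fin 4) (1 : ℝ) : E4)‖ = 2 := by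
    rw [norm_smul, PiLp.norm_single]; norm_num
  have hval : K6 ((-2 : ℝ) • EuclideanSpace.single 0 1) = -2880 / 2 ^ 8 := by
    unfold K6
    rw [hn]
    simp [Fin.sum_univ_four, PiLp.single_apply, q6]
    norm_num
  rw [hval] at key
  norm_num at key

/-- **THE ISOLATED OBSTRUCTION (near-miss, not closed): `K₆` is pointwise OS-positive across the
diagonal mirror `x₀ = x₁`.** Paper proof: in the frame of the unit normal `n = (e₀ − e₁)/√2`, the
half-space Laplace–Fourier representation `|x|⁻² = (4π)⁻¹ ∫_{ℝ³} e^{−|q| |x·n| + i q·x_⊥} d³q/|q|`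
(3D transform of `e^{−ωu}/ω`; elementary route: rotate `x_⊥ ∥ e₃`, polar coordinates in the `(q₁,q₂)`-plane,
`∫_{|q₃|}^∞ e^{−us}ds = e^{−u|q₃|}/u`, then the 1D transform of `e^{−u|q₃|}`) gives
`Σ cᵢcⱼ K₆(σxᵢ − xⱼ) = (4π)⁻¹ ∫ P_n(q) |Σ cᵢ e^{−|q|uᵢ + i q·wᵢ}|² d³q/|q|` with `uᵢ = (xᵢ⁰ − xᵢ¹)/√2 > 0`
and `P_n` = the symbol `Σ_μ k_μ⁶` on the complex locus of `n`, which is `diagSymbol_sextic_nonneg ≥ 0`.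
Numerics (cycle 3, pure python, folder `py/k6check.py`): derivative formula verified symbolically;
400 random diagonal-side configurations (2–9 points): min normalised Gram eigenvalue `+1.2·10⁻¹³`;
axis side: already the one-point Gram is `K₆(2e₀) < 0` (`K6_not_axis_positive`). Kit job j010725 (cycle 2)
agrees. What a Lean proof needs and the tree lacks: the 3D half-space representation above (no spherical /
cylindrical Fourier computation on `ℝ³` in Mathlib), or any Gram factorisation of
`1/((uᵢ+uⱼ)² + |wᵢ−wⱼ|²)` — every such factorisation needs `sinc |w|` (or the Poisson kernel) to be
positive-definite on `ℝ³`, i.e. the same spherical transform. -/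
theorem K6_diag_positive : ∀ (m : ℕ) (x : Fin m → E4) (c : Fin m → ℝ), (∀ i, x i 1 < x i 0) →
    0 ≤ ∑ i, ∑ j, c i * c j *
      K6 (LinearIsometryEquiv.piLpCongrLeft 2 ℝ ℝ (Equiv.swap (0 : Fin 4) 1) (x i) - x j) := by
  sorry

/-- **NEAR-MISS HEADLINE: the axis mirror is load-bearing given the twelve diagonal mirrors** —
`ShellRigidityWithoutAxis` is false, by the witness `K₆` (`K6_hypercubic`, `continuousOn_K6`,
`abs_K6_le` with `η = 2`, `K6_not_radial` — all kernel-checked) MODULO the single analytic lemma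
`K6_diag_positive` above (the only `sorry` of this workfile). -/
theorem shellRigidity_false_without_axis : ¬ ShellRigidityWithoutAxis := fun hS =>
  K6_not_radial (hS K6 continuousOn_K6 ⟨184320, 2, two_pos, abs_K6_le⟩
    (fun R hR x => K6_hypercubic R hR x) K6_diag_positive)

/-! ## §B — the planar threshold `σ = 8` is attained (cycle 2; LANDED p76045 / p78085; re-exported) -/

/-- §B (landed, p76045): `stub_planarAngularRigidity` with `σ ≤ 8` is false — `F₈ = cos 8φ/r⁸` with the
cone-boundary measures `mu8 ε`. -/
theorem planarThreshold_sharp : ¬ Theorems.ShellRigidity.Negative.PlanarAngularRigidityLe8 :=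
  Theorems.ShellRigidity.Negative.not_planarAngularRigidityLe8

/-! ## §B2 — pointwise version (LANDED p78085 as `Negative/PlanarPointwiseSharp.lean`; that module is not yet
built on the farm, so a verbatim copy stays here, over the imported `F8`/`mu8` kit of §B) -/

section B2

open Summit.QuantumFields.YangMills.Theorems.ShellRigidity.Negative
  (F8 mu8 integral_mu8 isFiniteMeasure_mu8 mu8_neg0 continuousOn_F8 abs_F8_le F8_symm F8_neg_fst F8_swap F8_diag
   F8_dir_pi_div_eight F8_one_zero)

/-! ## From Laplace–Fourier representations to POINTWISE mirror positivity, and the sharpness of the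
planar transfer target `C⁺ = PlanarShellRigidity` at `σ = 8` -/

/-- **A Laplace–Fourier-represented kernel is pointwise OS-positive.** If
`F(ε + t, b) = ∫ e^{-t p₀ + i b p₁} dμ` (`t ≥ 0`) for a finite positive measure `μ` carried by `{p₀ ≥ 0}`,
then `Σᵢⱼ cᵢcⱼ F(ε + τᵢ + τⱼ, sᵢ − sⱼ) = ∫ |Σᵢ cᵢ e^{-τᵢp₀ + i sᵢ p₁}|² dμ ≥ 0` for `τᵢ ≥ 0`.
(The easy half of the kernel-level OS/BCR correspondence; tool for both lanes.) [folklore] -/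
theorem sum_mul_mul_nonneg_of_laplaceRep (F : ℝ × ℝ → ℝ) (ε : ℝ) (μ : Measure E4) [IsFiniteMeasure μ]
    (hμ : μ {p | p 0 < 0} = 0)
    (hrep : ∀ t : ℝ, 0 ≤ t → ∀ b : ℝ, ((F (ε + t, b) : ℝ) : ℂ) =
      ∫ p, cexp ((((-(t * p 0) : ℝ)) : ℂ) + ((b * p 1 : ℝ) : ℂ) * I) ∂μ)
    {m : ℕ} (τ s c : Fin m → ℝ) (hτ : ∀ i, 0 ≤ τ i) :
    0 ≤ ∑ i, ∑ j, c i * c j * F (ε + (τ i + τ j), s i - s j) := by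
  set g : Fin m → E4 → ℂ := fun i q => cexp ((((-(τ i * q 0)) : ℝ) : ℂ) + ((s i * q 1 : ℝ) : ℂ) * I)
    with hg
  have hae : ∀ᵐ q ∂μ, 0 ≤ q 0 := by
    rw [ae_iff]
    have : {q : E4 | ¬ 0 ≤ q 0} = {q | q 0 < 0} := by ext q; simp [not_le]
    rw [this]; exact hμ
  have hgc : ∀ i, Continuous (g i) := by intro i; simp only [hg]; fun_prop
  have hgb : ∀ i, ∀ᵐ q ∂μ, ‖g i q‖ ≤ 1 := by
    intro i
    filter_upwards [hae] with q hq
    simp only [hg, Complex.norm_exp, Complex.add_re, Complex.ofReal_re, Complex.mul_re, Complex.I_re,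
      Complex.I_im, Complex.ofReal_im, mul_zero, zero_mul, sub_zero, add_zero, Real.exp_le_one_iff]
    nlinarith [hτ i]
  have hint : ∀ i j, Integrable (fun q => g i q * conj (g j q)) μ := by
    intro i j
    refine Integrable.of_bound
      (((hgc i).mul (Complex.continuous_conj.comp (hgc j))).aestronglyMeasurable) 1 ?_
    filter_upwards [hgb i, hgb j] with q hi hj
    rw [norm_mul, Complex.norm_conj]
    nlinarith [norm_nonneg (g i q), norm_nonneg (g j q)]
  -- the `(i,j)` integrand of `hrep` is `gᵢ · conj gⱼ`
  have hker : ∀ i j (q : E4),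
      cexp ((((-((τ i + τ j) * q 0)) : ℝ) : ℂ) + (((s i - s j) * q 1 : ℝ) : ℂ) * I)
        = g i q * conj (g j q) := by
    intro i j q
    simp only [hg, ← Complex.exp_conj, ← Complex.exp_add, map_add, map_mul, Complex.conj_ofReal,
      Complex.conj_I]
    congr 1
    push_cast; ring
  have hrep' : ∀ i j, ((F (ε + (τ i + τ j), s i - s j) : ℝ) : ℂ) = ∫ q, g i q * conj (g j q) ∂μ := by
    intro i j
    rw [hrep _ (add_nonneg (hτ i) (hτ j))]
    exact integral_congr_ae (ae_of_all _ (hker i j))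
  -- pointwise: `Σᵢⱼ cᵢcⱼ gᵢ conj gⱼ = |Σ cᵢgᵢ|²`
  have hpt : ∀ q : E4, ∑ i, ∑ j, (c i : ℂ) * (c j : ℂ) * (g i q * conj (g j q))
      = ((Complex.normSq (∑ i, (c i : ℂ) * g i q) : ℝ) : ℂ) := by
    intro q
    rw [← Complex.mul_conj, map_sum, Finset.sum_mul_sum]
    refine Finset.sum_congr rfl fun i _ => Finset.sum_congr rfl fun j _ => ?_
    simp only [map_mul, Complex.conj_ofReal]; ring
  have hsum : (((∑ i, ∑ j, c i * c j * F (ε + (τ i + τ j), s i - s j)) : ℝ) : ℂ)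
      = ((∫ q, Complex.normSq (∑ i, (c i : ℂ) * g i q) ∂μ : ℝ) : ℂ) := by
    push_cast
    simp_rw [hrep', ← integral_const_mul]
    rw [← integral_complex_ofReal]
    simp_rw [← hpt]
    rw [integral_finsetSum _ (fun i _ => integrable_finsetSum _ (fun j _ => (hint i j).const_mul _))]
    refine Finset.sum_congr rfl fun i _ => ?_
    rw [integral_finsetSum _ (fun j _ => (hint i j).const_mul _)]
  have hreal := Complex.ofReal_injective hsum
  rw [hreal]
  exact integral_nonneg fun q => Complex.normSq_nonneg _

/-- Verbatim `IsPlanarMirrorKernel` of the crux ideas (IdeatorSketch1.lean, cards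
`rapidity-liouville-spin-cutoff` / `transverse-smearing-planar-threshold`): a planar four-mirror kernel of
order `σ` — continuous off `0`, `|F x| ≤ C(1 + |x|^{-σ})`, `D₄`-symmetric, POINTWISE OS-positive across the
axis mirror `t = 0` (reflection `(t,s) ↦ (−t,s)`, side `t > 0`) and across the diagonal mirror `t = s`
(reflection `(t,s) ↦ (s,t)`, side `t > s`). -/
def IsPlanarMirrorKernel (F : ℝ × ℝ → ℝ) (σ : ℝ) : Prop :=
  ContinuousOn F {x | x ≠ 0} ∧
  (∃ C : ℝ, ∀ x : ℝ × ℝ, x ≠ 0 → |F x| ≤ C * (1 + (x.1 ^ 2 + x.2 ^ 2) ^ (-(σ / 2)))) ∧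
  (∀ t s : ℝ, F (t, s) = F (s, t) ∧ F (t, s) = F (t, -s) ∧ F (t, s) = F (-t, s)) ∧
  (∀ (m : ℕ) (x : Fin m → ℝ × ℝ) (c : Fin m → ℝ), (∀ i, 0 < (x i).1) →
      0 ≤ ∑ i, ∑ j, c i * c j * F (-(x i).1 - (x j).1, (x i).2 - (x j).2)) ∧
  (∀ (m : ℕ) (x : Fin m → ℝ × ℝ) (c : Fin m → ℝ), (∀ i, (x i).2 < (x i).1) →
      0 ≤ ∑ i, ∑ j, c i * c j * F ((x i).2 - (x j).1, (x i).1 - (x j).2))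

/-- Pointwise OS-positivity of `F₈` across the axis mirror `t = 0`. [folklore] -/
theorem F8_axis_pointwise (m : ℕ) (x : Fin m → ℝ × ℝ) (c : Fin m → ℝ) (hx : ∀ i, 0 < (x i).1) :
    0 ≤ ∑ i, ∑ j, c i * c j * F8 (-(x i).1 - (x j).1, (x i).2 - (x j).2) := by
  rcases isEmpty_or_nonempty (Fin m) with hm | hm
  · simp
  -- ε := the least time coordinate; representation at `ε/2`, `τᵢ := tᵢ − ε/4 ≥ 0`
  obtain ⟨i₀, -, hi₀⟩ := Finset.exists_min_image Finset.univ (fun i => (x i).1) Finset.univ_nonempty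
  set ε : ℝ := (x i₀).1 with hε
  have hεpos : 0 < ε := hx i₀
  have hεle : ∀ i, ε ≤ (x i).1 := fun i => hi₀ i (Finset.mem_univ i)
  haveI := isFiniteMeasure_mu8 (half_pos hεpos)
  have key := sum_mul_mul_nonneg_of_laplaceRep F8 (ε / 2) (mu8 (ε / 2)) (mu8_neg0 _)
    (fun t ht b => (integral_mu8 (half_pos hεpos) ht b).symm)
    (fun i => (x i).1 - ε / 4) (fun i => (x i).2) c (fun i => by linarith [hεle i])
  refine key.trans_eq (Finset.sum_congr rfl fun i _ => Finset.sum_congr rfl fun j _ => ?_)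
  have h1 : ε / 2 + ((x i).1 - ε / 4 + ((x j).1 - ε / 4)) = -(-(x i).1 - (x j).1) := by ring
  rw [h1, F8_neg_fst]

/-- Pointwise OS-positivity of `F₈` across the diagonal mirror `t = s`: in light-cone coordinates
`uᵢ = (tᵢ − sᵢ)/√2 > 0`, `wᵢ = (tᵢ + sᵢ)/√2` it is axis positivity, because `F₈ ∘ L = F₈`. [folklore] -/
theorem F8_diag_pointwise (m : ℕ) (x : Fin m → ℝ × ℝ) (c : Fin m → ℝ) (hx : ∀ i, (x i).2 < (x i).1) :
    0 ≤ ∑ i, ∑ j, c i * c j * F8 ((x i).2 - (x j).1, (x i).1 - (x j).2) := by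
  have hs : 0 < Real.sqrt 2 := Real.sqrt_pos.2 two_pos
  set y : Fin m → ℝ × ℝ := fun i => (((x i).1 - (x i).2) / Real.sqrt 2, ((x i).1 + (x i).2) / Real.sqrt 2)
    with hy
  have hy1 : ∀ i, 0 < (y i).1 := fun i => div_pos (by linarith [hx i]) hs
  refine (F8_axis_pointwise m y c hy1).trans_eq
    (Finset.sum_congr rfl fun i _ => Finset.sum_congr rfl fun j _ => ?_)
  congr 1
  -- F8 (−uᵢ − uⱼ, wᵢ − wⱼ) = F8 (sᵢ − tⱼ, tᵢ − sⱼ)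
  have h1 : F8 (-(y i).1 - (y j).1, (y i).2 - (y j).2) = F8 ((y i).2 - (y j).2, (y i).1 + (y j).1) := by
    rw [show -(y i).1 - (y j).1 = -((y i).1 + (y j).1) by ring, F8_neg_fst, F8_swap]
  rw [h1, ← F8_diag ((y i).2 - (y j).2) ((y i).1 + (y j).1),
    F8_swap ((x i).1 - (x j).2) ((x i).2 - (x j).1)]
  congr 1
  refine Prod.ext ?_ ?_
  · show ((y i).2 - (y j).2 + ((y i).1 + (y j).1)) / Real.sqrt 2 = (x i).1 - (x j).2
    simp only [hy]
    rw [← sub_div, ← add_div, ← add_div, div_div, Real.mul_self_sqrt two_pos.le]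
    ring
  · show ((y i).2 - (y j).2 - ((y i).1 + (y j).1)) / Real.sqrt 2 = (x i).2 - (x j).1
    simp only [hy]
    rw [← sub_div, ← add_div, ← sub_div, div_div, Real.mul_self_sqrt two_pos.le]
    ring

/-- `F₈` is a planar four-mirror kernel of order exactly `8`. [folklore] -/
theorem isPlanarMirrorKernel_F8 : IsPlanarMirrorKernel F8 8 :=
  ⟨continuousOn_F8, ⟨1, abs_F8_le⟩, F8_symm, F8_axis_pointwise, F8_diag_pointwise⟩

/-- The planar transfer target `C⁺ = PlanarShellRigidity` of the crux ideas with `σ < 8` relaxed to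
`σ ≤ 8`. -/
def PlanarShellRigidityLe8 : Prop :=
  ∀ (F : ℝ × ℝ → ℝ) (σ : ℝ), IsPlanarMirrorKernel F σ → σ ≤ 8 →
    ∀ r φ : ℝ, 0 < r → F (r * Real.cos φ, r * Real.sin φ) = F (r, 0)

/-- **`C⁺` is sharp at `σ = 8`** (the planar shadow of the crux's `η > 0`): `F₈ = cos(8φ)/r⁸` is a planar
four-mirror kernel of order `8` — continuous off `0`, `D₄`-symmetric, POINTWISE OS-positive across `t = 0`
and across `t = s` for all finite configurations — and is not radial. [folklore] -/
theorem not_planarShellRigidityLe8 : ¬ PlanarShellRigidityLe8 := by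
  intro h
  have key := h F8 8 isPlanarMirrorKernel_F8 le_rfl 1 (Real.pi / 8) one_pos
  rw [F8_dir_pi_div_eight, F8_one_zero] at key
  norm_num at key

end B2

/-! ## §B3 — `stub_fourierVanish` (lead skeleton v3) is sharp at `σ = 8` (cycle 3, NEW; standalone copy
submitted as `Negative/FourierVanishSharp.lean` — replace this section by an import once it is built) -/

/-- `stub_fourierVanish` of line `transverse-smearing-planar-threshold` (lead skeleton v3, 2026-08-16)
with its order hypothesis `σ < 8` RELAXED to `σ ≤ 8`; everything else verbatim. -/
def FourierVanishLe8 : Prop :=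
  ∀ (g : ℝ → ℂ), Continuous g → Function.Periodic g (Real.pi / 2) →
    ∀ (σ A B : ℝ), σ ≤ 8 →
    (∀ Ψ : ℝ, 0 < Ψ → ∃ h : ℂ → ℂ,
      DifferentiableOn ℂ h {w : ℂ | |w.re| < 3 * Real.pi / 8 ∧ |w.im| < Ψ} ∧
      (∀ α : ℝ, |α| < 3 * Real.pi / 8 → h α = g α) ∧
      (∀ y : ℝ, |y| < Ψ → h (((Real.pi / 4 : ℝ) : ℂ) + y * I) = h (((-(Real.pi / 4) : ℝ) : ℂ) + y * I)) ∧
      (∀ w : ℂ, |w.re| < 3 * Real.pi / 8 → |w.im| < Ψ → ‖h w‖ ≤ A + B * Real.exp (σ * |w.im|))) →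
    ∃ c₀ c₁ c₂ : ℂ, ∀ x : ℝ,
      g x = c₀ + c₁ * cexp (4 * (x : ℂ) * I) + c₂ * cexp (-(4 * (x : ℂ) * I))

/-- The witness: the pure Fourier mode `n = ±2`, `g(x) = cos 8x`. -/
def g8 (x : ℝ) : ℂ := Complex.cos (8 * (x : ℂ))

/-- Its chart, the entire function `cos 8w`. -/
def h8 (w : ℂ) : ℂ := Complex.cos (8 * w)

/-- `‖cos z‖ ≤ e^{|Im z|}`. [folklore] -/
theorem norm_cos_le_exp_abs_im (z : ℂ) : ‖Complex.cos z‖ ≤ Real.exp |z.im| := by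
  have h2 : Complex.cos z = (cexp (z * I) + cexp (-z * I)) / 2 := rfl
  rw [h2, norm_div, RCLike.norm_ofNat]
  have ha : ‖cexp (z * I)‖ ≤ Real.exp |z.im| := by
    rw [Complex.norm_exp]
    apply Real.exp_le_exp.2
    simp [neg_le_abs]
  have hb : ‖cexp (-z * I)‖ ≤ Real.exp |z.im| := by
    rw [Complex.norm_exp]
    apply Real.exp_le_exp.2
    simp [le_abs_self]
  have := norm_add_le (cexp (z * I)) (cexp (-z * I))
  linarith

/-- `g8` is continuous. [folklore] -/
theorem continuous_g8 : Continuous g8 := by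
  unfold g8; fun_prop

/-- `g8` is `π/2`-periodic. [folklore] -/
theorem periodic_g8 : Function.Periodic g8 (Real.pi / 2) := by
  intro x
  unfold g8
  have : (8 : ℂ) * (((x + Real.pi / 2 : ℝ)) : ℂ) = 8 * (x : ℂ) + (2 : ℕ) * (2 * Real.pi) := by
    push_cast; ring
  rw [this, Complex.cos_add_nat_mul_two_pi]

/-- `h8` is entire. [folklore] -/
theorem differentiable_h8 : Differentiable ℂ h8 :=
  Complex.differentiable_cos.comp (differentiable_id.const_mul (8 : ℂ))

/-- The vertical-line condition: `cos (2π + 8iy) = cos (-2π + 8iy)`. [folklore] -/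
theorem h8_vertical (y : ℝ) :
    h8 (((Real.pi / 4 : ℝ) : ℂ) + y * I) = h8 (((-(Real.pi / 4) : ℝ) : ℂ) + y * I) := by
  unfold h8
  have h1 : (8 : ℂ) * ((((Real.pi / 4 : ℝ)) : ℂ) + y * I) = 8 * (y : ℂ) * I + (1 : ℕ) * (2 * Real.pi) := by
    push_cast; ring
  have h2 : (8 : ℂ) * ((((-(Real.pi / 4) : ℝ)) : ℂ) + y * I) = 8 * (y : ℂ) * I - (1 : ℕ) * (2 * Real.pi) := by
    push_cast; ring
  rw [h1, h2, Complex.cos_add_nat_mul_two_pi, Complex.cos_sub_nat_mul_two_pi]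

/-- The type bound with `σ = 8`, `A = 0`, `B = 1`. [folklore] -/
theorem norm_h8_le (w : ℂ) : ‖h8 w‖ ≤ 0 + 1 * Real.exp (8 * |w.im|) := by
  unfold h8
  have := norm_cos_le_exp_abs_im (8 * w)
  have him : |(8 * w).im| = 8 * |w.im| := by
    simp [abs_mul]
  rw [him] at this
  linarith

/-- `g8` satisfies every hypothesis of the relaxed stub with `σ = 8`. [folklore] -/
theorem g8_charts : ∀ Ψ : ℝ, 0 < Ψ → ∃ h : ℂ → ℂ,
    DifferentiableOn ℂ h {w : ℂ | |w.re| < 3 * Real.pi / 8 ∧ |w.im| < Ψ} ∧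
    (∀ α : ℝ, |α| < 3 * Real.pi / 8 → h α = g8 α) ∧
    (∀ y : ℝ, |y| < Ψ → h (((Real.pi / 4 : ℝ) : ℂ) + y * I) = h (((-(Real.pi / 4) : ℝ) : ℂ) + y * I)) ∧
    (∀ w : ℂ, |w.re| < 3 * Real.pi / 8 → |w.im| < Ψ → ‖h w‖ ≤ 0 + 1 * Real.exp (8 * |w.im|)) :=
  fun _ _ => ⟨h8, differentiable_h8.differentiableOn, fun _ _ => rfl, fun y _ => h8_vertical y,
    fun w _ _ => norm_h8_le w⟩

/-- `cos 8x` is not a trigonometric polynomial of degree `≤ 1` in `e^{4ix}`. [folklore] -/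
theorem g8_not_span (c₀ c₁ c₂ : ℂ)
    (h : ∀ x : ℝ, g8 x = c₀ + c₁ * cexp (4 * (x : ℂ) * I) + c₂ * cexp (-(4 * (x : ℂ) * I))) : False := by
  have e0 := h 0
  have e1 := h (Real.pi / 4)
  have e2 := h (Real.pi / 8)
  have e3 := h (-(Real.pi / 8))
  -- values of g8
  have g0 : g8 0 = 1 := by simp [g8]
  have g1 : g8 (Real.pi / 4) = 1 := by
    unfold g8
    have : (8 : ℂ) * (((Real.pi / 4 : ℝ)) : ℂ) = 0 + (1 : ℕ) * (2 * Real.pi) := by push_cast; ring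
    rw [this, Complex.cos_add_nat_mul_two_pi, Complex.cos_zero]
  have g2 : g8 (Real.pi / 8) = -1 := by
    unfold g8
    have : (8 : ℂ) * (((Real.pi / 8 : ℝ)) : ℂ) = Real.pi := by push_cast; ring
    rw [this, Complex.cos_pi]
  have g3 : g8 (-(Real.pi / 8)) = -1 := by
    unfold g8
    have : (8 : ℂ) * (((-(Real.pi / 8) : ℝ)) : ℂ) = -Real.pi := by push_cast; ring
    rw [this, Complex.cos_neg, Complex.cos_pi]
  -- values of the exponentials
  have x0 : cexp (4 * ((0 : ℝ) : ℂ) * I) = 1 := by simp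
  have x0' : cexp (-(4 * ((0 : ℝ) : ℂ) * I)) = 1 := by simp
  have x1 : cexp (4 * (((Real.pi / 4 : ℝ)) : ℂ) * I) = -1 := by
    have : 4 * (((Real.pi / 4 : ℝ)) : ℂ) * I = Real.pi * I := by push_cast; ring
    rw [this, Complex.exp_pi_mul_I]
  have x1' : cexp (-(4 * (((Real.pi / 4 : ℝ)) : ℂ) * I)) = -1 := by
    have : -(4 * (((Real.pi / 4 : ℝ)) : ℂ) * I) = -(Real.pi * I) := by push_cast; ring
    rw [this, Complex.exp_neg, Complex.exp_pi_mul_I]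
    norm_num
  have x2 : cexp (4 * (((Real.pi / 8 : ℝ)) : ℂ) * I) = I := by
    have : 4 * (((Real.pi / 8 : ℝ)) : ℂ) * I = Real.pi / 2 * I := by push_cast; ring
    rw [this, Complex.exp_pi_div_two_mul_I]
  have x2' : cexp (-(4 * (((Real.pi / 8 : ℝ)) : ℂ) * I)) = -I := by
    have : -(4 * (((Real.pi / 8 : ℝ)) : ℂ) * I) = -(Real.pi / 2 * I) := by push_cast; ring
    rw [this, Complex.exp_neg, Complex.exp_pi_div_two_mul_I, Complex.inv_I]
  have x3 : cexp (4 * (((-(Real.pi / 8) : ℝ)) : ℂ) * I) = -I := by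
    have : 4 * (((-(Real.pi / 8) : ℝ)) : ℂ) * I = -(Real.pi / 2 * I) := by push_cast; ring
    rw [this, Complex.exp_neg, Complex.exp_pi_div_two_mul_I, Complex.inv_I]
  have x3' : cexp (-(4 * (((-(Real.pi / 8) : ℝ)) : ℂ) * I)) = I := by
    have : -(4 * (((-(Real.pi / 8) : ℝ)) : ℂ) * I) = Real.pi / 2 * I := by push_cast; ring
    rw [this, Complex.exp_pi_div_two_mul_I]
  rw [g0, x0, x0'] at e0
  rw [g1, x1, x1'] at e1
  rw [g2, x2, x2'] at e2
  rw [g3, x3, x3'] at e3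
  -- e0 + e1 : 2 = 2 c₀ ; e2 + e3 : -2 = 2 c₀
  have hsum : (2 : ℂ) = -2 := by
    calc (2 : ℂ) = (c₀ + c₁ * 1 + c₂ * 1) + (c₀ + c₁ * -1 + c₂ * -1) := by rw [← e0, ← e1]; norm_num
      _ = (c₀ + c₁ * I + c₂ * -I) + (c₀ + c₁ * -I + c₂ * I) := by ring
      _ = -1 + -1 := by rw [← e2, ← e3]
      _ = -2 := by norm_num
  norm_num at hsum

/-- **`stub_fourierVanish` is sharp at `σ = 8`**: with `σ < 8` relaxed to `σ ≤ 8` the statement is false —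
`g = cos 8x` with the entire chart `cos 8w` (`‖cos 8w‖ ≤ e^{8|Im w|}`) satisfies every hypothesis and is the
pure mode `n = ±2`. [folklore] -/
theorem not_fourierVanishLe8 : ¬ FourierVanishLe8 := by
  intro hFV
  obtain ⟨c₀, c₁, c₂, hc⟩ := hFV g8 continuous_g8 periodic_g8 8 0 1 le_rfl g8_charts
  exact g8_not_span c₀ c₁ c₂ hc

/-! ## §B4 — drefute's load-bearing lemmas for two landed stubs (LANDED p75006; importable from
`Summits.QuantumFields.YangMills.Theorems.ShellRigidity.Negative.TransverseSmearingLoadBearing`, imported here):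
`Theorems.ShellRigidity.Negative.coneOfDiscSections_false_without_uniform_bound` — in `stub_coneOfDiscSections`
the bound `M` must be uniform in the radius `t` (`∀ t, ∃ M` is false: Dirac mass at `e₁`);
`Theorems.ShellRigidity.Negative.axisLaplace_false_without_parity` — in `stub_axisLaplace` spatial parity cannot
be dropped (`e^{−|x₀|}(1 + ½ sin x₁)` is real-PSD across `x₀ = 0` but has no Laplace–Fourier representation). -/

example := @Theorems.ShellRigidity.Negative.coneOfDiscSections_false_without_uniform_bound
example := @Theorems.ShellRigidity.Negative.axisLaplace_false_without_parity

/-! ## §C — Targets (open stubs of both leads, cycle 3)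

No stub is broken or mis-stated; the per-stub audit is in the module docblock §C. Nothing to state in Lean:
a `theorem <stub>_false` exists for none of the ten. The provers' test cases are §B (`F₈`, planar stubs) and
§B3 (`cos 8x`, `stub_fourierVanish`). -/

/-! ## §D/§E — see the module docblock. The only `sorry` is `K6_diag_positive` (§A.3, obstruction documented
there). -/

end

end Summit.QuantumFields.YangMills.Cruxes.ShellRigidity.Disproof
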